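/-
Copyright: lit-balaban cell, Phase-2 proof seat p03.  Dictionary theorems (torus ↔ ℤ^d) for `BIJ85AxialGauge34`; nothing is
claimed beyond what the kernel checks below.
-/
import Mathlib
import Literature.MathematicalPhysics.QuantumFieldTheory.Balaban1983to89.B6Lemma24Torus
import Literature.MathematicalPhysics.QuantumFieldTheory.BalabanImbrieJaffe1984to88.BIJ85AxialGauge34

/-!
# `BalabanImbrieJaffe1984to88.BIJ85AxialGaugePeriodic` — T. Bałaban, J. Imbrie, A. Jaffe, *Renormalization of the Higgs
model …*, Commun. Math. Phys. **97** (1985) 299–329 [BalabanImbrieJaffe1985]: the periodic (toroidal) unit lattice of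
(2.2) versus the ℤ^d dictionary of `BIJ85AxialGauge34` — block-lattice translations commute with the contours Γ_{yx}, the
transports u(Γ_{yx}) and the axial gauge-fixing transformation of (3.4); hence periodic fields have periodic axial gauge
transforms and the ℤ^d statements of `BIJ85AxialGauge34` descend to the torus.  Theorems only (kernel lane).

statement-level skeleton of published theorems with citation tags; proofs where landed; nothing here is a claim about
the Yang–Mills mass gap

THE PRINTED SETTING (p. 302 [PDF 4]): *"‖φ‖²_a = Σ_{x∈T_a} |φ_x|² a^d, (2.2) where T_a denotes the a-lattice with periodic
(toroidal) boundary conditions"*; p. 306 [PDF 8] (3.4): the axial gauge is fixed block by block, *"Within each L-block B(y)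
with corner y in the L-lattice"*.  `BIJ85AxialGauge34` states (3.4), 𝒢₀ and the gauge fixing at every block of ℤ^d and
records (module docstring) that the torus is the case of periodic configurations; this file supplies the kernel facts
behind that sentence.  Seat p03, unit `lit-balaban-p03`, HOME `run/shared/lean/pub/lit-balaban/`.

WHAT IS PROVED (reusing the translation lemmas `B6Lemma24Torus.mem_block_add` / `mem_treeBonds_add` of the cell).  For a
block-lattice vector v (all coordinates divisible by L): `corner_add_of_dvd` (corner(x + v) = corner(x) + v), `contour_add` (Γ_{y+v, x+v} = Γ_{yx} + v as bond sets), `hol_translate`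
(u_{·+v}(Γ_{yx}) = u(Γ_{y+v,x+v})), `axialFix_translate` (h_{u(·+v)}(x) = h_u(x + v)), `isAxial_translate_iff`; and the
torus corollary `axialFix_periodic`: if u is periodic under x ↦ x + v then so is its axial gauge-fixing transformation h_u
(take v = N e_i with L ∣ N for the torus T₁ of side N).
-/

open Finset

namespace Literature.MathematicalPhysics.QuantumFieldTheory.BalabanImbrieJaffe1984to88.BIJ85AxialGaugePeriodic

open Literature.MathematicalPhysics.QuantumFieldTheory.Balaban1983to89
open B6Elimination B6BondElimination BIJ85AxialGauge34

noncomputable section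

variable {d : ℕ} {L : ℕ}

/-- Translating by a block-lattice vector moves corners along: corner(x + v) = corner(x) + v when L ∣ v_i.
[cite: BalabanImbrieJaffe1985, (2.4) p.302] -/
theorem corner_add_of_dvd (x : Fin d → ℤ) {v : Fin d → ℤ} (hv : ∀ i, (L : ℤ) ∣ v i) :
    corner L (x + v) = corner L x + v := by
  funext i
  obtain ⟨k, hk⟩ := hv i
  rw [corner_apply, Pi.add_apply, Pi.add_apply, corner_apply, hk]
  by_cases hL : (L : ℤ) = 0
  · simp [hL]
  · rw [Int.add_mul_ediv_left _ _ hL, mul_add]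

/-- The contours translate: Γ_{y+v, x+v} = Γ_{yx} + v (as sets of unit bonds). [cite: BalabanImbrieJaffe1985, (2.5) p.302] -/
theorem contour_add (y x v : Fin d → ℤ) :
    contour L (y + v) (x + v) = (contour L y x).map ⟨fun b => (b.1 + v, b.2), fun b b' h => by
      simpa [Prod.ext_iff, add_left_inj] using h⟩ := by
  ext ⟨w, μ⟩
  rw [Finset.mem_map, mem_contour]
  constructor
  · rintro ⟨hw, h1, h2, h3⟩
    refine ⟨(w - v, μ), ?_, ?_⟩
    · rw [mem_contour]
      refine ⟨?_, fun i hi => ?_, fun i hi => ?_, ?_⟩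
      · exact B6Lemma24Torus.mem_block_add.1 hw
      · have := h1 i hi
        simp only [Pi.sub_apply, Pi.add_apply] at this ⊢
        omega
      · have := h2 i hi
        simp only [Pi.sub_apply, Pi.add_apply] at this ⊢
        omega
      · simp only [Pi.sub_apply, Pi.add_apply] at h3 ⊢
        omega
    · simp
  · rintro ⟨⟨w', μ'⟩, hb, e⟩
    simp only [Function.Embedding.coeFn_mk, Prod.mk.injEq] at e
    obtain ⟨rfl, rfl⟩ := e
    obtain ⟨hw, h1, h2, h3⟩ := mem_contour.1 hb
    refine ⟨B6Lemma24Torus.mem_block_add.2 (by simpa using hw), fun i hi => ?_, fun i hi => ?_, ?_⟩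
    · have := h1 i hi
      simp only [Pi.add_apply] at this ⊢
      omega
    · have := h2 i hi
      simp only [Pi.add_apply] at this ⊢
      omega
    · simp only [Pi.add_apply] at h3 ⊢
      omega

/-- The transports translate: u_{·+v}(Γ_{yx}) = u(Γ_{y+v, x+v}). [cite: BalabanImbrieJaffe1985, (2.5) p.302] -/
theorem hol_translate (u : U1Cfg d) (y x v : Fin d → ℤ) :
    hol L (fun b => u (b.1 + v, b.2)) y x = hol L u (y + v) (x + v) := by
  unfold hol
  rw [contour_add, Finset.prod_map]
  rfl

/-- The axial gauge-fixing transformation commutes with block-lattice translations: h_{u(·+v)}(x) = h_u(x + v) for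
L ∣ v_i. [cite: BalabanImbrieJaffe1985, (3.4) p.306] -/
theorem axialFix_translate (u : U1Cfg d) {v : Fin d → ℤ} (hv : ∀ i, (L : ℤ) ∣ v i) (x : Fin d → ℤ) :
    axialFix L (fun b => u (b.1 + v, b.2)) x = axialFix L u (x + v) := by
  unfold axialFix
  rw [hol_translate, corner_add_of_dvd x hv]

/-- The tree bonds translate: b + v ∈ T(corner(b₋ + v)) iff b ∈ T(corner b₋), for L ∣ v_i. [cite: BalabanImbrieJaffe1985, (3.4) p.306] -/
theorem isTreeBond_add_iff {v : Fin d → ℤ} (hv : ∀ i, (L : ℤ) ∣ v i) (b : (Fin d → ℤ) × Fin d) :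
    IsTreeBond L (b.1 + v, b.2) ↔ IsTreeBond L b := by
  unfold IsTreeBond
  rw [corner_add_of_dvd b.1 hv, B6Lemma24Torus.mem_treeBonds_add, add_sub_cancel_right]

/-- The axial gauge is translation invariant along the block lattice: u(· + v) is axial iff u is (L ∣ v_i).
[cite: BalabanImbrieJaffe1985, (3.4) p.306] -/
theorem isAxial_translate_iff (u : U1Cfg d) {v : Fin d → ℤ} (hv : ∀ i, (L : ℤ) ∣ v i) :
    IsAxial L (fun b => u (b.1 + v, b.2)) ↔ IsAxial L u := by
  constructor
  · intro h b hb
    have := h (b.1 - v, b.2) (by rw [← isTreeBond_add_iff hv, sub_add_cancel]; exact hb)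
    simpa using this
  · intro h b hb
    exact h _ ((isTreeBond_add_iff hv b).2 hb)

/-- TORUS COROLLARY: if u is periodic under the block-lattice translation v (e.g. v = N e_i with L ∣ N — the torus T₁ of
side N of (2.2)), then its axial gauge-fixing transformation h_u is periodic under v as well, so h_u and the axial gauge
representative u^{h_u} descend to the torus. [cite: BalabanImbrieJaffe1985, (3.4) p.306] -/
theorem axialFix_periodic (u : U1Cfg d) {v : Fin d → ℤ} (hv : ∀ i, (L : ℤ) ∣ v i)
    (hu : ∀ b : (Fin d → ℤ) × Fin d, u (b.1 + v, b.2) = u b) (x : Fin d → ℤ) :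
    axialFix L u (x + v) = axialFix L u x := by
  rw [← axialFix_translate u hv x]
  congr 1
  funext b
  exact hu b

end

end Literature.MathematicalPhysics.QuantumFieldTheory.BalabanImbrieJaffe1984to88.BIJ85AxialGaugePeriodic
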